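import Mathlib.Algebra.Ring.GeomSum
import Mathlib.Algebra.BigOperators.Intervals
import Mathlib.Tactic.Ring
import Mathlib.Tactic.Linarith
import Mathlib.Tactic.Positivity

/-!
# `BalabanUV.Beta.FP.NestedCombRampDigits` — binder row D1 ∕ (C1) OWNER «beta-an2», PART 45: **THE NESTED COMB RAMP WITH CENTRED ROOTS EQUALS THE ONE-SHOT COMB RAMP**
# — the base-`L` digit identity behind LEMMA U (J-NOTE-19 §4, STUB U3): `Σ_{i<j} Lⁱ·((x / Lⁱ) mod L) = x mod Lʲ`, and with the centred root offset `c`, `2c + 1 = L`: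
# `Σ_{i<j} Lⁱ·((x / Lⁱ) mod L − c) = (x mod Lʲ) − (Lʲ − 1)/2` (as `2·(…) = 2·(x mod Lʲ) − (Lʲ − 1)` over `ℤ`)

WHY.  K2L-LAM (Engine C, by value, p = 4, n = 0): the translation-summed gauge column `Σ_z λ*_(μ,z)` is CONSTANT (4∕4) — the two charts (nested comb gauges τ₁∘τ₂ at centred
roots vs the one-shot `Lʲ`-block comb gauge + dressing) send UNIFORM data to the SAME axial representative.  The arithmetic heart: along the field's direction the nested axial
potential of a uniform unit field is the sum over storeys `i < j` of `Lⁱ·(i-th base-L digit of the fine coordinate − c)` (storey `i`'s comb ramp, root offset `c = (L−1)/2`, in units of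
`Lⁱ` fine bonds), the one-shot potential is `(x mod Lʲ) − (Lʲ−1)/2` (one ramp, root offset `(Lʲ−1)/2 = Σ_{i<j} c·Lⁱ`); this file proves they are EQUAL for every `x`, `j`, `L = 2c+1`.
§1 **`sum_pow_mul_digit_eq_mod`** (`Σ_{i<j} Lⁱ·((x/Lⁱ) mod L) = x mod Lʲ`, induction on core's `Nat.mod_pow_succ`);
§2 `two_mul_ctr_mul_geom_sum` (`2c + 1 = L ⇒ 2·c·Σ_{i<j} Lⁱ = Lʲ − 1` over `ℤ`), **`two_mul_sum_pow_mul_centredDigit`** (`2·Σ_{i<j} Lⁱ·((x/Lⁱ) mod L − c) = 2·(x mod Lʲ) − (Lʲ − 1)`).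
[folklore] elementary `ℕ`∕`ℤ` arithmetic, Mathlib only; no `def`, nothing cited, 0 sorry.  It asserts nothing about the charts (LEMMA U's U1∕U2 — the charts' action on uniform
data — are the ONE file's); nothing of Bałaban's; 0∕4 row-D1 binders; NOT (C1), NOT D1, NEVER «G-an2-4 closed», NOT BetaPertH, NOT continuum, NOT Clay.
HONEST DEPENDENCY (page 1, mandatory): continuum YM on T⁴ ⇐ BetaPertH ∧ nine spine estimates (0/9 proved); BetaPertH ⇐ (D1) ∧ (D4) ∧ CAP+tail;
G-an2-4 gates asym, D1 and NE2/3/4.  HONEST FRAMING (cell contract, verbatim): «discharging `BetaPertH` makes Bałaban's UV stability UNCONDITIONAL —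
a real constructive-QFT result; it is NOT the continuum limit and NOT the Clay problem.»  ABSOLUTE RULE (cell charter, verbatim): «No internally-minted
statement may enter as a cited fact. Every hypothesis is either kernel-proved in this package or a verbatim quotation of a PUBLISHED theorem with page
reference. The manuscript(s) under audit are NOT citable for their own disputed steps — they are the thing under adjudication; programme-internal
(2001/route/tribunal) claims are never citable.»  Row D1 ∕ (C1) OWNER, b2b-balaban-beta-an2 gen 75, 2026-08-28.  No existing file touched.
-/

open scoped BigOperators

namespace Summit.QuantumFields.BalabanUV.Beta.FP.NestedCombRampDigits

open Finset

/-! ## §1 Base-`L` digits reassemble the residue -/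

/-- [folklore] **`sum_pow_mul_digit_eq_mod`**: the first `j` base-`L` digits of `x`, weighted by the powers of `L`, reassemble `x mod Lʲ`:
`Σ_{i<j} Lⁱ·((x / Lⁱ) mod L) = x mod Lʲ`. -/
theorem sum_pow_mul_digit_eq_mod (L x j : ℕ) : ∑ i ∈ range j, L ^ i * (x / L ^ i % L) = x % L ^ j := by
  induction j with
  | zero => simp [Nat.mod_one]
  | succ j ih => rw [Finset.sum_range_succ, ih, Nat.mod_pow_succ]

/-! ## §2 Centred roots: the nested ramp is the one-shot ramp -/

/-- [folklore] with the centred root offset (`2c + 1 = L`): `2·c·Σ_{i<j} Lⁱ = Lʲ − 1` over `ℤ` (`geom_sum_mul`). -/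
theorem two_mul_ctr_mul_geom_sum (L c : ℕ) (hc : 2 * c + 1 = L) (j : ℕ) :
    (2 : ℤ) * c * ∑ i ∈ range j, (L : ℤ) ^ i = (L : ℤ) ^ j - 1 := by
  have hL : ((L : ℤ) - 1) = 2 * c := by
    have : (L : ℤ) = 2 * c + 1 := by exact_mod_cast hc.symm
    linarith
  rw [← geom_sum_mul (L : ℤ) j, hL]
  ring

/-- [folklore] **`two_mul_sum_pow_mul_centredDigit` — THE NESTED COMB RAMP EQUALS THE ONE-SHOT COMB RAMP**: for `2c + 1 = L`,
`2·Σ_{i<j} Lⁱ·(((x / Lⁱ) mod L) − c) = 2·(x mod Lʲ) − (Lʲ − 1)` over `ℤ` — the sum of the storey ramps with centred roots is the single ramp with the centred big root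
`(Lʲ − 1)/2`; at `L = 3`, `j = 2`: `(x mod 3 − 1) + 3·((x/3) mod 3 − 1) = (x mod 9) − 4`. -/
theorem two_mul_sum_pow_mul_centredDigit (L c x : ℕ) (hc : 2 * c + 1 = L) (j : ℕ) :
    (2 : ℤ) * ∑ i ∈ range j, (L : ℤ) ^ i * (((x / L ^ i % L : ℕ) : ℤ) - c) = 2 * ((x % L ^ j : ℕ) : ℤ) - ((L : ℤ) ^ j - 1) := by
  have h1 : ∑ i ∈ range j, (L : ℤ) ^ i * (((x / L ^ i % L : ℕ) : ℤ) - c)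
      = (∑ i ∈ range j, ((L ^ i * (x / L ^ i % L) : ℕ) : ℤ)) - (c : ℤ) * ∑ i ∈ range j, (L : ℤ) ^ i := by
    rw [Finset.mul_sum, ← Finset.sum_sub_distrib]
    exact Finset.sum_congr rfl fun i _ => by push_cast; ring
  rw [h1, ← Nat.cast_sum, sum_pow_mul_digit_eq_mod L x j, ← two_mul_ctr_mul_geom_sum L c hc j]
  ring

/-- [folklore] the instance of record (`L = 3`, centred offset `c = 1`, two storeys): `(x mod 3 − 1) + 3·((x / 3) mod 3 − 1) = (x mod 9) − 4`. -/
theorem nestedRamp_three_two (x : ℕ) : (((x % 3 : ℕ) : ℤ) - 1) + 3 * (((x / 3 % 3 : ℕ) : ℤ) - 1) = ((x % 9 : ℕ) : ℤ) - 4 := by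
  have h := two_mul_sum_pow_mul_centredDigit 3 1 x rfl 2
  simp only [Finset.sum_range_succ, Finset.sum_range_zero, zero_add, pow_zero, one_mul, pow_one, Nat.div_one] at h
  push_cast at h ⊢
  linarith

end Summit.QuantumFields.BalabanUV.Beta.FP.NestedCombRampDigits
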